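import Literature.AnabelianGeometry.EtaleTheta.Discharge.Sec5Thm57KummerTorsionOfEtaleTower
import Literature.AnabelianGeometry.EtaleTheta.Discharge.Sec5Thm57EtaleTorsionOfRigidityTowerHsepPow

/-!
# [EtTh] §5, Theorem 5.7 (C)-chain: the torsion clause `htors` of a normalised transport datum from the étale residual list WITH THE
# REPAIRED separation binder `hsep^{(2l)}` (twin of abc-iut-w6-d049's `kummerTorsion_of_etaleTower`, p478416)

Mochizuki, *The étale theta function and its Frobenioid-theoretic manifestations*, Publ. RIMS **45** (2009)
[cite: MochizukiEtTh2009, Thm 5.7 proof p.330 (PDF p.104); Thm 5.6 p.328 (PDF p.102); Prop 5.2 (iii) p.324 (PDF p.98); Cor 2.19 (iii)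
p.291 (PDF p.65); Cor 2.8 (i) p.268 (PDF p.42)].  Layer L2 of the abc-iut cell, seat abc-iut-f-123 (gen 8), abc-iut-L2-lead rows
R983/R1139/R1164 «HSEP@TATE-DATUM».  PROOF-ONLY twin (0 definitions) of `Discharge/Sec5Thm57KummerTorsionOfEtaleTower` (p478416):
statement and proof VERBATIM except that the cross-level separation binder is the REPAIRED `hsepPow` — «two compatible families of
members with `aug`-inflated ratio differ, at every level `M`, by a function whose `(2l)`-th power is a `μ_M`-coboundary» — and the
étale torsion step is this seat's twin `ThetaEnvTower.etaleTorsion_of_cor219iiiStd_of_hsepPow` (p498016).  WHY: the original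
exponent-`2` binder `hsep` is UNINHABITABLE whenever `μ_l ⊆ K` (p497402; at the Tate datum of record for `l ∣ p − 1`, p498173), while
`hsepPow` follows from Prop. 1.5 (ii)/(iii)-shaped inputs (p500847) and HOLDS at the Tate datum of record (p503064).  Conclusion
token-identical to p478416.  All helpers (`ThetaFrobenioid.exists_kappa_discrepancy_hC5`, `kummerTorsion_of_etaleTorsion`) consumed
BY NAME; nothing landed is edited.
HONEST FRAMING: kernel-checked composition; none of the displayed binders is proved here or asserted to hold at any model; nothing of
[EtTh] is asserted unconditionally; typed ≠ discharged; no side taken on anything downstream ([IUTchIII] Cor. 3.12 in particular).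
-/

namespace Literature.AnabelianGeometry.EtaleTheta

open CategoryTheory
open Literature.AlgebraicGeometry.Frobenioids

universe w v v' u u'

namespace ThetaFrobenioidTower

variable {C : Type u} [Category.{v} C] {D : Type u'} [Category.{v'} D] (𝔗 : ThetaFrobenioidTower.{w} C D)
  (Ψ : C ≌ C) {E : Set ℕ+} (𝒯 : ThetaEnvTower.{v} E)

/-- **The torsion clause of ONE normalised transport datum from the étale residual list, with the REPAIRED separation binder
`hsepPow`** (exponent `2·l`): twin of abc-iut-w6-d049's `kummerTorsion_of_etaleTower` (p478416), conclusion VERBATIM the member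
shape of '_final_v6''s `htorsfam` (`n := 2l`): `∃ u ∈ μ_N(B_N), ∀ k ∈ Π^tp_Ÿ̲, s^⊔-gp_N(ρk)·w^{2l}·s^⊔-gp_N(ρk)⁻¹·w^{−2l} =
s^⊔-gp_N(ρk)·u·s^⊔-gp_N(ρk)⁻¹·u⁻¹`; the étale torsion step is `ThetaEnvTower.etaleTorsion_of_cor219iiiStd_of_hsepPow` (p498016).
[cite: MochizukiEtTh2009, Thm 5.7 proof p.330 (PDF p.104); Thm 5.6 p.328 (PDF p.102); Prop 5.2 (iii) p.324 (PDF p.98); Cor 2.19 (iii) p.291 (PDF p.65)] -/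
theorem kummerTorsion_of_etaleTower_of_hsepPow
    -- the §5 ↔ §2 dictionary at every level `M ∈ E`
    (ι : 𝔗.PiX ≃* 𝒯.PiX) (hι : ∀ y : 𝔗.PiX, y ∈ 𝔗.PiYdd ↔ ι y ∈ 𝒯.PiYdd)
    (m : ∀ M : E, (𝔗.atLevel M).muTorsion (𝔗.atLevel M).BN (𝔗.atLevel M).N ≃* (𝒯.level M).mu)
    (hχ : ∀ M : E, (𝔗.atLevel M).CyclotomicCharacterCompat (𝒯.level M) ι (m M))
    (H : ∀ M : E, (𝔗.atLevel M).Facts)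
    (η : ∀ M : E, 𝒯.PiYdd → 𝒯.mu M) (hη : ∀ M, η M ∈ 𝒯.thetaCocycles M)
    (hηc : ∀ (M M' : E) (h : (M : ℕ+) ∣ M'), 𝒯.red M M' h ∘ η M' = η M)
    (hpin : ∀ M : E, (𝔗.atLevel M).ThetaSectionCompat (H M) (𝒯.level M) ι (m M) hι (η M))
    -- étale side on the tower
    (γ : 𝒯.PiX ≃ₜ* 𝒯.PiX) (hγ : 𝒯.PiYdd.map γ.toMulEquiv.toMonoidHom = 𝒯.PiYdd)
    (hγ' : ∀ x : 𝒯.PiX, x ∈ 𝒯.PiYdd → γ x ∈ 𝒯.PiYdd) (γμ : ∀ M : E, 𝒯.mu M ≃* 𝒯.mu M)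
    (hstd : ∃ cf : ∀ M : E, 𝒯.G → 𝒯.mu M,
      (∀ M, CycEnvelope.IsEnvCocycle (MonoidHom.id 𝒯.G) (𝒯.chi M) (cf M)) ∧
      (∀ M, IsLocallyConstant (cf M ∘ 𝒯.aug)) ∧
      (∀ (M M' : E) (h : (M : ℕ+) ∣ M'), 𝒯.red M M' h ∘ cf M' = cf M) ∧
      (∀ M, 𝒯.pullbackCocycle M γ hγ (γμ M) '' 𝒯.thetaCocycles M =
        (fun η => η * (cf M ∘ 𝒯.aug ∘ 𝒯.PiYdd.subtype)) '' 𝒯.thetaCocycles M) ∧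
      ∀ M : E, ∃ d : 𝒯.mu M, ∀ g : 𝒯.G, cf M g ^ 𝔗.l = CycEnvelope.coboundary (MonoidHom.id 𝒯.G) (𝒯.chi M) d g)
    (hγμχ : ∀ (M : E) (x : 𝒯.PiX) (t : 𝒯.mu M), γμ M (𝒯.chi M (𝒯.aug x) t) = 𝒯.chi M (𝒯.aug (γ x)) (γμ M t))
    (hγμred : ∀ (M M' : E) (h : (M : ℕ+) ∣ M') (t : 𝒯.mu M'), 𝒯.red M M' h (γμ M' t) = γμ M (𝒯.red M M' h t))
    (haug : ∀ x y : 𝒯.PiX, 𝒯.aug x = 𝒯.aug y → 𝒯.aug (γ x) = 𝒯.aug (γ y))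
    -- translation-freeness in étale currency: `γ^*η_M / η_M` is inflated at every level
    (hinfη : ∀ (M : E) (k k' : 𝒯.PiYdd), 𝒯.aug k = 𝒯.aug k' →
      (η M k)⁻¹ * γμ M (η M ⟨γ.symm k, 𝒯.symm_apply_mem_PiYdd_of_map_eq γ hγ k k.2⟩) =
        (η M k')⁻¹ * γμ M (η M ⟨γ.symm k', 𝒯.symm_apply_mem_PiYdd_of_map_eq γ hγ k' k'.2⟩))
    -- separation across levels, REPAIRED form (exponent `2·l`, abc-iut-f-123 p497402/p498016/p498173/p500847/p503064)
    (hsepPow : ∀ η' : ∀ M : E, 𝒯.PiYdd → 𝒯.mu M, (∀ M, η' M ∈ 𝒯.thetaCocycles M) →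
      (∀ (M M' : E) (h : (M : ℕ+) ∣ M'), 𝒯.red M M' h ∘ η' M' = η' M) →
      (∀ (M : E) (k k' : 𝒯.PiYdd), 𝒯.aug k = 𝒯.aug k' → η' M k * (η M k)⁻¹ = η' M k' * (η M k')⁻¹) →
      ∀ M : E, ∃ d : 𝒯.mu M, ∀ k : 𝒯.PiYdd,
        (η' M k * (η M k)⁻¹) ^ (2 * 𝔗.l) = CycEnvelope.coboundary (𝒯.aug.comp 𝒯.PiYdd.subtype) (𝒯.chi M) d k)
    -- ONE normalised transport datum at a level `N ∈ E`, over a base shadow `θ` compatible with `γ`, with (K4m)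
    {N : ℕ+} (hN : N ∈ E)
    (a : Ψ.functor.obj (𝔗.AN N) ≅ 𝔗.AN N) (b : Ψ.functor.obj (𝔗.BN N) ≅ 𝔗.BN N) (e : 𝔗.AN N ≅ 𝔗.AN N) (w : Aut (𝔗.BN N))
    (θ : Aut (𝔗.pre.base.obj (𝔗.BN N)) ≃* Aut (𝔗.pre.base.obj (𝔗.BN N)))
    (hYdd : (𝔗.atLevel N).HB.map θ.toMonoidHom = (𝔗.atLevel N).HB)
    (hT : a.inv ≫ Ψ.functor.map (𝔗.sCap N) ≫ b.hom = e.hom ≫ 𝔗.sCap N ≫ (1 : Aut (𝔗.BN N)).hom)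
    (hT' : a.inv ≫ Ψ.functor.map (𝔗.sCup N) ≫ b.hom = e.hom ≫ 𝔗.sCup N ≫ w.hom)
    (hstrv : (𝔗.atLevel N).StrvTransport Ψ a e θ) (hw : w ∈ (𝔗.atLevel N).units (𝔗.BN N))
    (hshadow : ∀ k : 𝔗.PiYdd, θ (𝔗.ρ N k) = 𝔗.ρ N (ι.symm (γ (ι k))))
    (hK4 : ∀ x : 𝒯.mu ⟨N, hN⟩, (𝔗.atLevel N).psiAut Ψ b
        (((m ⟨N, hN⟩).symm x : (𝔗.atLevel N).muTorsion (𝔗.atLevel N).BN (𝔗.atLevel N).N) : Aut (𝔗.atLevel N).BN) =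
      (((m ⟨N, hN⟩).symm (γμ ⟨N, hN⟩ x) : (𝔗.atLevel N).muTorsion (𝔗.atLevel N).BN (𝔗.atLevel N).N) :
        Aut (𝔗.atLevel N).BN)) :
    ∃ u ∈ (𝔗.atLevel N).muTorsion (𝔗.BN N) N, ∀ k : (𝔗.atLevel N).PiYdd,
      𝔗.sgpCup N ((𝔗.atLevel N).rhoYdd k) * w ^ (2 * 𝔗.l) * (𝔗.sgpCup N ((𝔗.atLevel N).rhoYdd k))⁻¹ * (w ^ (2 * 𝔗.l))⁻¹ =
        𝔗.sgpCup N ((𝔗.atLevel N).rhoYdd k) * u * (𝔗.sgpCup N ((𝔗.atLevel N).rhoYdd k))⁻¹ * u⁻¹ := by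
  haveI : Epi (𝔗.atLevel N).sCup := (H ⟨N, hN⟩).epi_sCup
  -- the DETERMINED cocycle family `κ^η_M(k) := η_M(k)⁻¹ · γ_μ(η_M(γ⁻¹ k))` and its `hC5` (by construction)
  have hC5η : ∀ (M : E) (k : 𝒯.PiYdd), γμ M (η M k) =
      η M ⟨γ k, hγ' k k.2⟩ * ((η M ⟨γ k, hγ' k k.2⟩)⁻¹ *
        γμ M (η M ⟨γ.symm (γ k), 𝒯.symm_apply_mem_PiYdd_of_map_eq γ hγ (γ k) (hγ' k k.2)⟩)) := by
    intro M k
    rw [mul_inv_cancel_left]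
    exact congrArg (fun x : 𝒯.PiYdd => γμ M (η M x)) (Subtype.ext (γ.symm_apply_apply (k : 𝒯.PiX)).symm)
  -- its torsion at level `N` (p476411's twin with the repaired binder, p498016)
  obtain ⟨d, hd⟩ := 𝒯.etaleTorsion_of_cor219iiiStd_of_hsepPow γ hγ hγ' γμ hstd hγμχ hγμred haug η hη hηc
    (fun M k => (η M k)⁻¹ * γμ M (η M ⟨γ.symm k, 𝒯.symm_apply_mem_PiYdd_of_map_eq γ hγ k k.2⟩)) hC5η hinfη hsepPow ⟨N, hN⟩
  -- the HC-tautology at the member (p473560): `κ` with `hκ`@`w` and `hC5`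
  obtain ⟨κ, hκw, hC5κ⟩ := ThetaFrobenioid.exists_kappa_discrepancy_hC5 (𝔉 := 𝔗.atLevel N) (H ⟨N, hN⟩) (𝒯.level ⟨N, hN⟩) ι
    (m ⟨N, hN⟩) hι (hpin ⟨N, hN⟩) Ψ a b e w θ hYdd hT hT' hstrv γ hγ' (γμ ⟨N, hN⟩) hshadow hK4
  -- `hC5` determines `κ`: it IS `κ^η_N`
  have hκη : ∀ k' : 𝒯.PiYdd, κ k' =
      (η ⟨N, hN⟩ k')⁻¹ * γμ ⟨N, hN⟩ (η ⟨N, hN⟩ ⟨γ.symm k', 𝒯.symm_apply_mem_PiYdd_of_map_eq γ hγ k' k'.2⟩) := by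
    intro k'
    have hk₀ : γ.symm (k' : 𝒯.PiX) ∈ 𝒯.PiYdd := 𝒯.symm_apply_mem_PiYdd_of_map_eq γ hγ k' k'.2
    have ek : (⟨γ (γ.symm (k' : 𝒯.PiX)), hγ' _ hk₀⟩ : 𝒯.PiYdd) = k' := Subtype.ext (γ.apply_symm_apply (k' : 𝒯.PiX))
    have h1 := hC5κ ⟨γ.symm (k' : 𝒯.PiX), hk₀⟩
    rw [ek] at h1
    exact eq_inv_mul_of_mul_eq h1.symm
  -- the dictionary step (p473372)
  exact ThetaFrobenioid.kummerTorsion_of_etaleTorsion (𝔉 := 𝔗.atLevel N) (𝒯.level ⟨N, hN⟩) ι (m ⟨N, hN⟩) hι (hχ ⟨N, hN⟩)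
    (H ⟨N, hN⟩).biKummerDifferenceMem hw κ hκw (2 * 𝔗.l) ⟨d, fun k => by rw [hκη]; exact hd k⟩

end ThetaFrobenioidTower

end Literature.AnabelianGeometry.EtaleTheta
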